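import Summits.HubbardSuperconductivity.HubbardSuperconductivity.Theorems.ThermalWedgeTwSeededRungNarrowSeed

/-!
# Route `ThermalWedge` — the ANCHOR `TwSeededRung` (stmt-HubbardSuperconductivity-1699) from the
# THERMAL-WINDOW restatement of the ensemble crux (`∃ a`, seed floor `K'·U`)

Route-file-free companion of `ThermalWedgeTwSeededRungNarrowSeed.lean` (verbatim bodies of the route
declarations; no import of `Theses/ThermalWedge.lean`). The landed engine
`twSeededRung_structural_narrowSeed` asks the canonical/grand-canonical DEFECT bound of the seeded model
(crux `TwSeededEnsembleEquivalence`, stmt-HubbardSuperconductivity-1698) on the thermal window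
`1 ≤ β ≤ e^{a/U}` for EVERY `a > 0`. That is more than positive-temperature technology can give and more
than the anchor needs: convergent sourced expansions reach `β ≤ e^{a₀/U}` for ONE `a₀` fixed by the model
(barrier `WeakCouplingCeiling`: the running coupling `U log β` must stay small), exactly as the two sourced
cruxes `TwSourcedInertness` / `TwSourcedCondensation` are filed (`∃ U₀ a …`). Here the ensemble input is
asked in the SAME shape — for SOME `a > 0` (with `K', U₀`), `μ` chosen before `ε` — and the anchor still
follows from it and `TwSourcedCondensation` AS FILED: run the master rung inequality at the common
exponent `a := min aᵉ aᶜ` (`β = e^{a/U}` lies in both windows), probe source `s = e^{-a/(4U)}`,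
allowance `ε = c a s²/(32U)`, seed floor `K = max (16/(ca)) K'`; output `c(U,g) = c a s²/(8Ug)`.
* `twSeededRung_structural_thermalWindow` — the engine;
* `tw_thermalWindowEnsemble_of_forallA` — the `∀ a` input of `twSeededRung_structural_narrowSeed`
  implies the `∃ a` input (take `a = 1`), so nothing landed is lost and the as-filed crux (via
  `tw_seedNarrowedEnsemble_of_betaNarrowed ∘ tw_narrowEnsembleEquivalence_of`) serves it too.
This is the weakest restatement of stmt-…-1698 recommended by its line lead (c1, 2026-08-16) that the
route's glue consumes. [folklore]
-/

set_option linter.dupNamespace false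

namespace Summit.HubbardSuperconductivity.HubbardSuperconductivity.Theorems

open Literature.MathematicalPhysics.QuantumLattice Matrix

/-- **Structural engine of the anchor from the THERMAL-WINDOW ensemble input (`∃ a`).** Hypothesis 1 =
`TwSeededEnsembleEquivalence` restated on `1 ≤ β ≤ e^{a/U}` and seeds `g ∈ [K'·U, 1/10]` for SOME
`a, K', U₀ > 0` (window `[μ₁,μ₂]` first, `μ` before `ε`); hypothesis 2 = `TwSourcedCondensation`
(verbatim body, as filed); conclusion = `TwSeededRung` (verbatim body) with `K = max (16/(ca)) K'`,
`a = min aᵉ aᶜ`. Proof: `tw_rung_master` at `(β, μ, s) = (e^{a/U}, μ, e^{-a/(4U)})` + `twr_margin`.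
[folklore] -/
theorem twSeededRung_structural_thermalWindow
    (hEns : ∀ δ ∈ Set.Icc (1/10 : ℝ) (2/5 : ℝ), ∃ μ₁ μ₂ : ℝ, -4 < μ₁ ∧ μ₁ ≤ μ₂ ∧ μ₂ < 0 ∧
      ∃ a K' U₀ : ℝ, 0 < a ∧ 0 < K' ∧ 0 < U₀ ∧ ∀ U ∈ Set.Ioc (0 : ℝ) U₀,
        ∀ g ∈ Set.Icc (K' * U) (1 / 10), ∀ β : ℝ, 1 ≤ β → β ≤ Real.exp (a / U) →
          ∃ μ ∈ Set.Icc μ₁ μ₂, ∀ ε : ℝ, 0 < ε → ∃ L₀ : ℕ, ∀ (L : ℕ) [NeZero L], L₀ ≤ L →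
            ((hubbardTorus 2 L 1 U - ((g / (L : ℝ) ^ 2 : ℝ) : ℂ) •
              ((pairField dWaveFormFactor L)ᴴ * pairField dWaveFormFactor L)).minEnergyOn
                (szSector (Λ := FermionTorus 2 L) (2 * ⌊(1 - δ) * (L : ℝ) ^ 2 / 2⌋₊) 0) /
                  (L : ℝ) ^ 2) +
              (Real.log (Matrix.partitionFn β (hubbardTorusWith 2 L 1 U μ -
                ((g / (L : ℝ) ^ 2 : ℝ) : ℂ) •
                  ((pairField dWaveFormFactor L)ᴴ * pairField dWaveFormFactor L))).re /
                    (β * (L : ℝ) ^ 2)) -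
              μ * ((2 * ⌊(1 - δ) * (L : ℝ) ^ 2 / 2⌋₊) : ℝ) / (L : ℝ) ^ 2 ≤ Real.log 4 / β + ε)
    (hCond : ∀ μ₁ μ₂ : ℝ, -4 < μ₁ → μ₁ ≤ μ₂ → μ₂ < 0 → ∃ U₀ a c C h₀ : ℝ, 0 < U₀ ∧ 0 < a ∧ 0 < c ∧
      0 < C ∧ 0 < h₀ ∧ ∀ U : ℝ, 0 < U → U ≤ U₀ → ∀ β : ℝ, 1 ≤ β → β ≤ Real.exp (a / U) →
        ∀ μ ∈ Set.Icc μ₁ μ₂, ∃ L₀ : ℕ, ∀ (L : ℕ) [NeZero L], L₀ ≤ L → ∀ h : ℝ, |h| ≤ h₀ →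
          c * h ^ 2 * Real.log (1 / (|h| + 1 / β)) - C * h ^ 2 ≤
            (Real.log (Matrix.partitionFn β (dWaveSourceTorus L U μ h)).re / (β * (L : ℝ) ^ 2)) -
              (Real.log (Matrix.partitionFn β (dWaveSourceTorus L U μ 0)).re / (β * (L : ℝ) ^ 2))) :
    ∀ δ ∈ Set.Icc (1/10 : ℝ) (2/5 : ℝ), ∃ U₀ K : ℝ, 0 < U₀ ∧ 0 < K ∧ K * U₀ ≤ 1 / 20 ∧
      ∀ U ∈ Set.Ioc (0 : ℝ) U₀, (∀ g ∈ Set.Icc (K * U) (1 / 10), ∃ c : ℝ, 0 < c ∧ ∃ L₀ : ℕ,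
        ∀ (L : ℕ) [NeZero L], L₀ ≤ L → Even L →
          ∀ (ψ : Fock (Orb (FermionTorus 2 L))), star ψ ⬝ᵥ ψ = 1 →
            IsGroundStateInSector (hubbardTorus 2 L 1 U - ((g / (L : ℝ) ^ 2 : ℝ) : ℂ) •
              ((pairField dWaveFormFactor L)ᴴ * pairField dWaveFormFactor L))
                (2 * ⌊(1 - δ) * (L : ℝ) ^ 2 / 2⌋₊) 0 ψ →
            c * (L : ℝ) ^ 4 ≤
              (expect ((pairField dWaveFormFactor L)ᴴ * pairField dWaveFormFactor L) ψ).re) := by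
  intro δ hδ
  obtain ⟨μ₁, μ₂, hμ₁, hμ₁₂, hμ₂, aE, K', U₀e, haE, hK', hU₀e, hE⟩ := hEns δ hδ
  obtain ⟨U₀c, aC, c, C, h₀, hU₀c, haC, hc, hC, hh₀, hCo⟩ := hCond μ₁ μ₂ hμ₁ hμ₁₂ hμ₂
  -- the common exponent: the SMALLER of the two thermal windows
  set a : ℝ := min aE aC with hadef
  have ha : 0 < a := lt_min haE haC
  have haE' : a ≤ aE := min_le_left _ _
  have haC' : a ≤ aC := min_le_right _ _
  have hlog2 : 0 < Real.log 2 := Real.log_pos (by norm_num)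
  have hlog4 : 0 < Real.log 4 := Real.log_pos (by norm_num)
  have hden : 0 < c * Real.log 2 + C + Real.log 4 := by positivity
  -- constants: the seed floor is the larger of the glue's `16/(ca)` and the crux's `K'`
  set K₀ : ℝ := 16 / (c * a) with hK₀def
  have hK₀ : 0 < K₀ := by positivity
  set K : ℝ := max K₀ K' with hKdef
  have hK₀K : K₀ ≤ K := le_max_left _ _
  have hK'K : K' ≤ K := le_max_right _ _
  have hK : 0 < K := hK₀.trans_le hK₀K
  set U₁ : ℝ := a * h₀ / 4 with hU₁def
  set U₂ : ℝ := c * a / (32 * (c * Real.log 2 + C + Real.log 4)) with hU₂def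
  have hU₁ : 0 < U₁ := by positivity
  have hU₂ : 0 < U₂ := by positivity
  have h20K : 0 < 1 / (20 * K) := by positivity
  set U₀ : ℝ := min (min U₀e U₀c) (min (1 / (20 * K)) (min U₁ U₂)) with hU₀def
  have hU₀ : 0 < U₀ := lt_min (lt_min hU₀e hU₀c) (lt_min h20K (lt_min hU₁ hU₂))
  refine ⟨U₀, K, hU₀, hK, ?_, ?_⟩
  · have h1 : U₀ ≤ 1 / (20 * K) := (min_le_right _ _).trans (min_le_left _ _)
    calc K * U₀ ≤ K * (1 / (20 * K)) := mul_le_mul_of_nonneg_left h1 hK.le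
      _ = 1 / 20 := by field_simp
  intro U hU g hg
  obtain ⟨hU0, hUle⟩ := hU
  obtain ⟨hKU, hg10⟩ := hg
  have hUe : U ≤ U₀e := hUle.trans ((min_le_left _ _).trans (min_le_left _ _))
  have hUc : U ≤ U₀c := hUle.trans ((min_le_left _ _).trans (min_le_right _ _))
  have hUU₁ : U ≤ U₁ :=
    hUle.trans ((min_le_right _ _).trans ((min_le_right _ _).trans (min_le_left _ _)))
  have hUU₂ : U ≤ U₂ :=
    hUle.trans ((min_le_right _ _).trans ((min_le_right _ _).trans (min_le_right _ _)))
  have hK₀Upos : 0 < K₀ * U := mul_pos hK₀ hU0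
  have hK₀U : K₀ * U ≤ g := (mul_le_mul_of_nonneg_right hK₀K hU0.le).trans hKU
  have hK'U : K' * U ≤ g := (mul_le_mul_of_nonneg_right hK'K hU0.le).trans hKU
  have hgpos : 0 < g := hK₀Upos.trans_le hK₀U
  have hginv : 1 / g ≤ c * a / (16 * U) := by
    have h1 := one_div_le_one_div_of_le hK₀Upos hK₀U
    have e : 1 / (K₀ * U) = c * a / (16 * U) := by
      rw [hK₀def]
      field_simp
    linarith
  have hsmall : c * Real.log 2 + C + Real.log 4 ≤ c * a / (32 * U) := by
    rw [hU₂def, le_div_iff₀ (by positivity)] at hUU₂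
    rw [le_div_iff₀ (by positivity)]
    linarith
  -- temperature, probe source, allowance
  set β : ℝ := Real.exp (a / U) with hβdef
  have haU : 0 < a / U := div_pos ha hU0
  have hβ1 : 1 ≤ β := Real.one_le_exp haU.le
  have hβpos : 0 < β := Real.exp_pos _
  set s : ℝ := Real.exp (-(a / (4 * U))) with hsdef
  have hspos : 0 < s := Real.exp_pos _
  have hs_le : s ≤ h₀ := by
    have hx : 0 < a / (4 * U) := by positivity
    have h1 : a / (4 * U) + 1 ≤ Real.exp (a / (4 * U)) := Real.add_one_le_exp _
    have h2 : s = (Real.exp (a / (4 * U)))⁻¹ := by rw [hsdef, Real.exp_neg]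
    have h3 : s ≤ (a / (4 * U))⁻¹ := by
      rw [h2]
      exact inv_anti₀ hx (by linarith)
    have h4 : (a / (4 * U))⁻¹ = 4 * U / a := by rw [inv_div]
    have h5 : 4 * U / a ≤ h₀ := by
      rw [div_le_iff₀ ha]
      rw [hU₁def, le_div_iff₀ (by norm_num : (0 : ℝ) < 4)] at hUU₁
      linarith
    linarith [h4 ▸ h3]
  set ε : ℝ := c * a / (32 * U) * s ^ 2 with hεdef
  have hε : 0 < ε := by positivity
  -- `β = e^{a/U}` lies in BOTH thermal windows
  have hβE : β ≤ Real.exp (aE / U) :=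
    Real.exp_le_exp.2 (div_le_div_of_nonneg_right haE' hU0.le)
  have hβC : β ≤ Real.exp (aC / U) :=
    Real.exp_le_exp.2 (div_le_div_of_nonneg_right haC' hU0.le)
  -- the canonical chemical potential (chosen before `ε`) and the thresholds
  obtain ⟨μ, hμ, hE'⟩ := hE U ⟨hU0, hUe⟩ g ⟨hK'U, hg10⟩ β hβ1 hβE
  obtain ⟨L₁, hL₁⟩ := hE' ε hε
  obtain ⟨L₂, hL₂⟩ := hCo U hU0 hUc β hβ1 hβC μ hμ
  refine ⟨c * a * s ^ 2 / (8 * U) / g, by positivity, max L₁ L₂, ?_⟩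
  intro L _ hL _hEven ψ hψ hgs
  have hL1 : L₁ ≤ L := (le_max_left _ _).trans hL
  have hL2 : L₂ ≤ L := (le_max_right _ _).trans hL
  have hLpos : (0 : ℝ) < (L : ℝ) := by exact_mod_cast NeZero.pos L
  have hL4 : (0 : ℝ) < (L : ℝ) ^ 4 := by positivity
  have hup := hL₁ L hL1
  have hcond := hL₂ L hL2 s (by rw [abs_of_pos hspos]; exact hs_le)
  -- the master inequality at `(β, μ, s)` and the margin
  have hmaster := tw_rung_master L U μ hβpos hgpos s hψ hgs
  have hn' : μ * ((2 * ⌊(1 - δ) * (L : ℝ) ^ 2 / 2⌋₊ : ℕ) : ℝ) / (L : ℝ) ^ 2 =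
      μ * ((2 * ⌊(1 - δ) * (L : ℝ) ^ 2 / 2⌋₊) : ℝ) / (L : ℝ) ^ 2 := by
    push_cast
    ring
  rw [hn'] at hmaster
  have hm := twr_margin (g := g) ha hc hU0 hβdef hsdef hginv hsmall hεdef
  -- `c a s²/(8U) ≤ (g/L⁴)·P`, hence `(c a s²/(8U)/g)·L⁴ ≤ P`
  have key : c * a * s ^ 2 / (8 * U) ≤ g / (L : ℝ) ^ 4 *
      (expect ((pairField dWaveFormFactor L)ᴴ * pairField dWaveFormFactor L) ψ).re := by
    linarith
  have h1 : c * a * s ^ 2 / (8 * U) * (L : ℝ) ^ 4 ≤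
      g * (expect ((pairField dWaveFormFactor L)ᴴ * pairField dWaveFormFactor L) ψ).re := by
    have h2 := mul_le_mul_of_nonneg_right key hL4.le
    have h3 : g / (L : ℝ) ^ 4 *
        (expect ((pairField dWaveFormFactor L)ᴴ * pairField dWaveFormFactor L) ψ).re * (L : ℝ) ^ 4 =
        g * (expect ((pairField dWaveFormFactor L)ᴴ * pairField dWaveFormFactor L) ψ).re := by
      field_simp
    linarith
  rw [div_mul_eq_mul_div, div_le_iff₀ hgpos]
  linarith

/-- The `∀ a` (seed-narrowed) ensemble input of `twSeededRung_structural_narrowSeed` implies the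
thermal-window (`∃ a`) input of `twSeededRung_structural_thermalWindow` (take `a = 1`). -/
theorem tw_thermalWindowEnsemble_of_forallA
    (hEns : ∀ δ ∈ Set.Icc (1/10 : ℝ) (2/5 : ℝ), ∃ μ₁ μ₂ : ℝ, -4 < μ₁ ∧ μ₁ ≤ μ₂ ∧ μ₂ < 0 ∧
      ∀ a : ℝ, 0 < a → ∃ K' U₀ : ℝ, 0 < K' ∧ 0 < U₀ ∧ ∀ U ∈ Set.Ioc (0 : ℝ) U₀,
        ∀ g ∈ Set.Icc (K' * U) (1 / 10), ∀ β : ℝ, 1 ≤ β → β ≤ Real.exp (a / U) →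
          ∃ μ ∈ Set.Icc μ₁ μ₂, ∀ ε : ℝ, 0 < ε → ∃ L₀ : ℕ, ∀ (L : ℕ) [NeZero L], L₀ ≤ L →
            ((hubbardTorus 2 L 1 U - ((g / (L : ℝ) ^ 2 : ℝ) : ℂ) •
              ((pairField dWaveFormFactor L)ᴴ * pairField dWaveFormFactor L)).minEnergyOn
                (szSector (Λ := FermionTorus 2 L) (2 * ⌊(1 - δ) * (L : ℝ) ^ 2 / 2⌋₊) 0) /
                  (L : ℝ) ^ 2) +
              (Real.log (Matrix.partitionFn β (hubbardTorusWith 2 L 1 U μ -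
                ((g / (L : ℝ) ^ 2 : ℝ) : ℂ) •
                  ((pairField dWaveFormFactor L)ᴴ * pairField dWaveFormFactor L))).re /
                    (β * (L : ℝ) ^ 2)) -
              μ * ((2 * ⌊(1 - δ) * (L : ℝ) ^ 2 / 2⌋₊) : ℝ) / (L : ℝ) ^ 2 ≤ Real.log 4 / β + ε) :
    ∀ δ ∈ Set.Icc (1/10 : ℝ) (2/5 : ℝ), ∃ μ₁ μ₂ : ℝ, -4 < μ₁ ∧ μ₁ ≤ μ₂ ∧ μ₂ < 0 ∧
      ∃ a K' U₀ : ℝ, 0 < a ∧ 0 < K' ∧ 0 < U₀ ∧ ∀ U ∈ Set.Ioc (0 : ℝ) U₀,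
        ∀ g ∈ Set.Icc (K' * U) (1 / 10), ∀ β : ℝ, 1 ≤ β → β ≤ Real.exp (a / U) →
          ∃ μ ∈ Set.Icc μ₁ μ₂, ∀ ε : ℝ, 0 < ε → ∃ L₀ : ℕ, ∀ (L : ℕ) [NeZero L], L₀ ≤ L →
            ((hubbardTorus 2 L 1 U - ((g / (L : ℝ) ^ 2 : ℝ) : ℂ) •
              ((pairField dWaveFormFactor L)ᴴ * pairField dWaveFormFactor L)).minEnergyOn
                (szSector (Λ := FermionTorus 2 L) (2 * ⌊(1 - δ) * (L : ℝ) ^ 2 / 2⌋₊) 0) /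
                  (L : ℝ) ^ 2) +
              (Real.log (Matrix.partitionFn β (hubbardTorusWith 2 L 1 U μ -
                ((g / (L : ℝ) ^ 2 : ℝ) : ℂ) •
                  ((pairField dWaveFormFactor L)ᴴ * pairField dWaveFormFactor L))).re /
                    (β * (L : ℝ) ^ 2)) -
              μ * ((2 * ⌊(1 - δ) * (L : ℝ) ^ 2 / 2⌋₊) : ℝ) / (L : ℝ) ^ 2 ≤ Real.log 4 / β + ε := by
  intro δ hδ
  obtain ⟨μ₁, μ₂, hμ₁, hμ₁₂, hμ₂, hEa⟩ := hEns δ hδ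
  obtain ⟨K', U₀, hK', hU₀, hE⟩ := hEa 1 one_pos
  exact ⟨μ₁, μ₂, hμ₁, hμ₁₂, hμ₂, 1, K', U₀, one_pos, hK', hU₀, hE⟩

end Summit.HubbardSuperconductivity.HubbardSuperconductivity.Theorems
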